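import Mathlib.LinearAlgebra.TensorProduct.Map
import Mathlib.LinearAlgebra.TensorProduct.Associator
import Mathlib.LinearAlgebra.Basis.Defs
import Mathlib.Algebra.Module.LinearMap.End
import Mathlib.Algebra.Group.Action.Basic
import HarnessLib

/-!
# An additive map commuting with the rank-one endomorphisms of a module with a unimodular vector is a scalar

Topic `LinearAlgebra`; theorems only (no definition, no named fact, no `sorry`).  Cell
`pub/bsd-print-x9` (BSD ladder row 9, 2026-08-28), kernel obligation (n2) of the print-exactness
certificate for the pinned finite–singular slot of Howard's Kolyvagin systems
(`Literature.NumberTheory.GaloisCohomology.Howard2004.FiniteSingularNatural`, reading note (v):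
«an additive map `T' ⊗ A → T' ⊗ B` commuting with `M₂(R') ⊗ 1` is `1 ⊗ φ₀` … a unit iff
bijective»).  The pure module algebra, for a module `M` over a (semi)ring `R` possessing a
**unimodular pair** `(x₀, φ)` — a vector `x₀ ∈ M` and a linear form `φ : M → R` with `φ x₀ = 1`
(every free module of positive rank: `φ = b.coord i`, `x₀ = b i`; Howard's `T'` is free of rank two
by H.0):

* `apply_eq_smul_of_forall_apply_smulRight` — an ADDITIVE `f : M → M` with
  `f (φ y • x) = φ (f y) • x` for all `x y` (i.e. commuting with the rank-one endomorphisms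
  `y ↦ φ y • x = LinearMap.smulRight φ x`) is the scalar `u := φ (f x₀)`: `f z = u • z`;
  `isUnit_of_forall_apply_smulRight_of_surjective` — if moreover `f` is onto, `u` is a unit;
  `exists_units_smul_eq_of_forall_apply_smulRight` — `∃ u : Rˣ, f = u • id`.
* `apply_eq_map_smul_of_forall_intertwine` — the «two natural maps differ by a scalar» form used by
  the certificate: `e : M ≃+ Q` and `f : M →+ Q` both intertwining, for every rank-one endomorphism
  `g` of `M`, one and the same self-map `G` of `Q` (`e ∘ g = G ∘ e`, `f ∘ g = G ∘ f`) satisfy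
  `f z = e (u • z)` with `u = φ (e⁻¹ (f x₀))`, a unit when `f` is onto
  (`isUnit_of_forall_intertwine_of_surjective`).  (Instance: `M = T'`, `Q = H¹_s(K_λ, T') ⊗ G_ℓ`,
  `e = φ^{fs} ∘ ev⁻¹`, `f = fs ∘ ev⁻¹`, `G = H¹_s(g) ⊗ 1`.)
* `map_tmul_eq_tmul_of_forall_rTensor_smulRight` — the tensor form: an additive
  `f : M ⊗ A → M ⊗ B` commuting with every `(φ.smulRight x) ⊗ 1` is `1 ⊗ φ₀` on pure tensors,
  `f (z ⊗ a) = z ⊗ φ₀ a` with `φ₀ a = (φ ⊗ 1) (f (x₀ ⊗ a))` read in `R ⊗ B = B`.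
* `Basis.coord_apply_self_eq_one` packaging: a basis vector and its coordinate form are a unimodular
  pair (`exists_units_smul_eq_of_forall_comp_eq_comp` — the form quantified over ALL linear
  endomorphisms, for a free module with a named basis vector).

Source: N. Jacobson, *Lectures in Abstract Algebra II* (1953), Ch. III §18 Theorem 20′ («the only
endomorphisms of ℜ which commute with every 𝔬-endomorphism are the scalar multiplications»; held
`book:jacobson1953-lectures-abstract-algebra`, chunk p0130; bib key `Jacobson`), printed for
finitely generated modules over a principal ideal domain (the tree's
`Literature.LinearAlgebra.EndomorphismBicommutant` records Thm 20′ itself as not formalised).  The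
forms below are the ones the certificate consumes: the hypothesis «`M` has a unimodular pair»
(true for Jacobson's modules with a free summand, and for every free module of positive rank over
any commutative ring) replaces the structure theory — one rank-one endomorphism `y ↦ φ y • z`
applied to `x₀` already reads off `f z` — and the maps are merely additive.  No Mathlib
counterpart beyond the matrix form `Matrix.mem_range_scalar_iff_commute_single` / the instance
`Algebra.IsCentral k (Module.End k V)` for vector spaces.
-/

namespace Literature.LinearAlgebra

open scoped TensorProduct

section Scalar

variable {R : Type*} [Semiring R] {M : Type*} [AddCommMonoid M] [Module R M]

/-- **An additive map commuting with the rank-one endomorphisms is a scalar.**  If `φ x₀ = 1` and the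
additive map `f : M → M` satisfies `f (φ y • x) = φ (f y) • x` for all `x, y` (it commutes with every
`LinearMap.smulRight φ x : y ↦ φ y • x`), then `f z = φ (f x₀) • z` for every `z`. [cite: Jacobson, Ch. III §18 Theorem 20' (p0130)] -/
theorem apply_eq_smul_of_forall_apply_smulRight (f : M →+ M) {x₀ : M} {φ : M →ₗ[R] R}
    (hφ : φ x₀ = 1) (hf : ∀ x y : M, f (φ y • x) = φ (f y) • x) (z : M) :
    f z = φ (f x₀) • z := by
  simpa [hφ] using hf z x₀

/-- The same with the hypothesis phrased through `LinearMap.smulRight`: `f` commutes with every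
rank-one endomorphism `φ.smulRight x`. [cite: Jacobson, Ch. III §18 Theorem 20' (p0130)] -/
theorem apply_eq_smul_of_forall_comp_smulRight (f : M →+ M) {x₀ : M} {φ : M →ₗ[R] R}
    (hφ : φ x₀ = 1)
    (hf : ∀ x : M, f.comp (φ.smulRight x).toAddMonoidHom = (φ.smulRight x).toAddMonoidHom.comp f)
    (z : M) : f z = φ (f x₀) • z :=
  apply_eq_smul_of_forall_apply_smulRight f hφ
    (fun x y => by simpa using DFunLike.congr_fun (hf x) y) z

/-- In particular such an `f` commutes with EVERY scalar: `f (r • z) = r • f z` need not hold for a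
non-commutative `R`, but `f` is the left multiplication by the fixed scalar `φ (f x₀)`; over a
commutative `R` it is `R`-linear. [cite: Jacobson, Ch. III §18 Theorem 20' (p0130)] -/
theorem map_smul_of_forall_apply_smulRight {R : Type*} [CommSemiring R] {M : Type*}
    [AddCommMonoid M] [Module R M] (f : M →+ M) {x₀ : M} {φ : M →ₗ[R] R} (hφ : φ x₀ = 1)
    (hf : ∀ x y : M, f (φ y • x) = φ (f y) • x) (r : R) (z : M) : f (r • z) = r • f z := by
  rw [apply_eq_smul_of_forall_apply_smulRight f hφ hf (r • z),
    apply_eq_smul_of_forall_apply_smulRight f hφ hf z, smul_comm]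

end Scalar

section Unit

variable {R : Type*} [CommSemiring R] {M : Type*} [AddCommMonoid M] [Module R M]

/-- **A surjective additive map commuting with the rank-one endomorphisms is a UNIT scalar**: with
`φ x₀ = 1` and `f (φ y • x) = φ (f y) • x`, if `f` is onto then `φ (f x₀)` is a unit of `R`
(`x₀ = f y = u • y`, so `1 = φ x₀ = u · φ y`). [cite: Jacobson, Ch. III §18 Theorem 20' (p0130)] -/
theorem isUnit_of_forall_apply_smulRight_of_surjective (f : M →+ M) {x₀ : M} {φ : M →ₗ[R] R}
    (hφ : φ x₀ = 1) (hf : ∀ x y : M, f (φ y • x) = φ (f y) • x)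
    (hsurj : Function.Surjective f) : IsUnit (φ (f x₀)) := by
  obtain ⟨y, hy⟩ := hsurj x₀
  have h1 : φ x₀ = φ (f x₀) * φ y := by
    conv_lhs => rw [← hy, apply_eq_smul_of_forall_apply_smulRight f hφ hf y]
    rw [map_smul, smul_eq_mul]
  exact IsUnit.of_mul_eq_one (φ y) (by rw [← h1, hφ])

/-- **Unit form**: a surjective additive `f : M → M` commuting with the rank-one endomorphisms of a
module with a unimodular pair is `z ↦ u • z` for a unit `u ∈ Rˣ`. [cite: Jacobson, Ch. III §18 Theorem 20' (p0130)] -/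
theorem exists_units_smul_eq_of_forall_apply_smulRight (f : M →+ M) {x₀ : M} {φ : M →ₗ[R] R}
    (hφ : φ x₀ = 1) (hf : ∀ x y : M, f (φ y • x) = φ (f y) • x)
    (hsurj : Function.Surjective f) : ∃ u : Rˣ, ∀ z : M, f z = (u : R) • z :=
  ⟨(isUnit_of_forall_apply_smulRight_of_surjective f hφ hf hsurj).unit, fun z => by
    rw [IsUnit.unit_spec]; exact apply_eq_smul_of_forall_apply_smulRight f hφ hf z⟩

/-- Conversely (bookkeeping): `z ↦ u • z` for a unit `u` is a bijection of `M`. [cite: Jacobson, Ch. III §18 Theorem 20' (p0130)] -/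
theorem bijective_units_smul (u : Rˣ) : Function.Bijective fun z : M => (u : R) • z :=
  (MulAction.toPerm u : Equiv.Perm M).bijective

end Unit

section Intertwine

variable {R : Type*} [CommSemiring R] {M : Type*} [AddCommMonoid M] [Module R M]
  {Q : Type*} [AddCommMonoid Q]

/-- **Two maps intertwining the same induced endomorphisms differ by a scalar.**  Let `(x₀, φ)` be
a unimodular pair of `M`, `e : M ≃+ Q` an additive bijection and `f : M →+ Q` additive.  Suppose
that for every `x : M` there is a self-map `G` of `Q` with `e (φ y • x) = G (e y)` and
`f (φ y • x) = G (f y)` for all `y` (both `e` and `f` are «natural» along the rank-one endomorphism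
`y ↦ φ y • x`, with the same induced map on `Q`).  Then `f z = e (u • z)` with
`u = φ (e⁻¹ (f x₀))`. [cite: Jacobson, Ch. III §18 Theorem 20' (p0130)] -/
theorem apply_eq_map_smul_of_forall_intertwine (e : M ≃+ Q) (f : M →+ Q) {x₀ : M}
    {φ : M →ₗ[R] R} (hφ : φ x₀ = 1)
    (h : ∀ x : M, ∃ G : Q → Q, (∀ y, e (φ y • x) = G (e y)) ∧ ∀ y, f (φ y • x) = G (f y))
    (z : M) : f z = e (φ (e.symm (f x₀)) • z) := by
  have key : ∀ x y : M, e.symm (f (φ y • x)) = φ (e.symm (f y)) • x := by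
    intro x y
    obtain ⟨G, hGe, hGf⟩ := h x
    rw [hGf, AddEquiv.symm_apply_eq, hGe, AddEquiv.apply_symm_apply]
  have key' : ∀ x y : M,
      (e.symm.toAddMonoidHom.comp f) (φ y • x) = φ ((e.symm.toAddMonoidHom.comp f) y) • x :=
    key
  have := apply_eq_smul_of_forall_apply_smulRight (e.symm.toAddMonoidHom.comp f) hφ key' z
  change e.symm (f z) = φ (e.symm (f x₀)) • z at this
  exact (AddEquiv.symm_apply_eq _).mp this

/-- … and the scalar is a UNIT when `f` is onto: `f = e ∘ (u • ·)` with `u ∈ Rˣ`. [cite: Jacobson, Ch. III §18 Theorem 20' (p0130)] -/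
theorem isUnit_of_forall_intertwine_of_surjective (e : M ≃+ Q) (f : M →+ Q) {x₀ : M}
    {φ : M →ₗ[R] R} (hφ : φ x₀ = 1)
    (h : ∀ x : M, ∃ G : Q → Q, (∀ y, e (φ y • x) = G (e y)) ∧ ∀ y, f (φ y • x) = G (f y))
    (hsurj : Function.Surjective f) : IsUnit (φ (e.symm (f x₀))) := by
  have key : ∀ x y : M, e.symm (f (φ y • x)) = φ (e.symm (f y)) • x := by
    intro x y
    obtain ⟨G, hGe, hGf⟩ := h x
    rw [hGf, AddEquiv.symm_apply_eq, hGe, AddEquiv.apply_symm_apply]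
  have key' : ∀ x y : M,
      (e.symm.toAddMonoidHom.comp f) (φ y • x) = φ ((e.symm.toAddMonoidHom.comp f) y) • x :=
    key
  have hs : Function.Surjective (e.symm.toAddMonoidHom.comp f) := e.symm.surjective.comp hsurj
  exact isUnit_of_forall_apply_smulRight_of_surjective (e.symm.toAddMonoidHom.comp f) hφ key' hs

/-- **Unit form of the intertwining lemma**: under the hypotheses of
`apply_eq_map_smul_of_forall_intertwine` with `f` onto, `∃ u : Rˣ, ∀ z, f z = e (u • z)` — «the two
natural bijections differ by a unit scalar». [cite: Jacobson, Ch. III §18 Theorem 20' (p0130)] -/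
theorem exists_units_apply_eq_map_smul_of_forall_intertwine (e : M ≃+ Q) (f : M →+ Q) {x₀ : M}
    {φ : M →ₗ[R] R} (hφ : φ x₀ = 1)
    (h : ∀ x : M, ∃ G : Q → Q, (∀ y, e (φ y • x) = G (e y)) ∧ ∀ y, f (φ y • x) = G (f y))
    (hsurj : Function.Surjective f) : ∃ u : Rˣ, ∀ z : M, f z = e ((u : R) • z) :=
  ⟨(isUnit_of_forall_intertwine_of_surjective e f hφ h hsurj).unit, fun z => by
    rw [IsUnit.unit_spec]; exact apply_eq_map_smul_of_forall_intertwine e f hφ h z⟩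

end Intertwine

section Tensor

variable {R : Type*} [CommSemiring R] {M : Type*} [AddCommMonoid M] [Module R M]
  {A : Type*} [AddCommMonoid A] [Module R A] {B : Type*} [AddCommMonoid B] [Module R B]

/-- The rank-one endomorphism `y ↦ φ y • z` tensored with `B` is `t ↦ z ⊗ ((φ ⊗ 1) t)`:
`(φ.smulRight z ⊗ 1) (m ⊗ b) = (φ m • z) ⊗ b = z ⊗ (φ m • b)`. [cite: Jacobson, Ch. III §18 Theorem 20' (p0130)] -/
theorem rTensor_smulRight_apply (φ : M →ₗ[R] R) (z : M) (t : M ⊗[R] B) :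
    (φ.smulRight z).rTensor B t = z ⊗ₜ[R] TensorProduct.lid R B (φ.rTensor B t) := by
  induction t using TensorProduct.induction_on with
  | zero => simp
  | tmul m b =>
    simp [LinearMap.rTensor_tmul, LinearMap.smulRight_apply, TensorProduct.lid_tmul,
      TensorProduct.smul_tmul]
  | add s t hs ht => simp [hs, ht, TensorProduct.tmul_add]

/-- **The commutant of `End_R(M) ⊗ 1` is `1 ⊗ Hom(A, B)`** (unimodular form, on pure tensors): if
`φ x₀ = 1` and the additive `f : M ⊗ A → M ⊗ B` commutes with every `(φ.smulRight z) ⊗ 1`, then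
`f (z ⊗ a) = z ⊗ φ₀ a` where `φ₀ a := (φ ⊗ 1) (f (x₀ ⊗ a))` read in `R ⊗ B = B`. [cite: Jacobson, Ch. III §18 Theorem 20' (p0130)] -/
theorem map_tmul_eq_tmul_of_forall_rTensor_smulRight (f : M ⊗[R] A →+ M ⊗[R] B) {x₀ : M}
    {φ : M →ₗ[R] R} (hφ : φ x₀ = 1)
    (hf : ∀ (z : M) (t : M ⊗[R] A), f ((φ.smulRight z).rTensor A t) = (φ.smulRight z).rTensor B (f t))
    (z : M) (a : A) :
    f (z ⊗ₜ[R] a) = z ⊗ₜ[R] TensorProduct.lid R B (φ.rTensor B (f (x₀ ⊗ₜ[R] a))) := by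
  have h1 : (φ.smulRight z).rTensor A (x₀ ⊗ₜ[R] a) = z ⊗ₜ[R] a := by
    simp [hφ]
  rw [← h1, hf, rTensor_smulRight_apply]

/-- The map `φ₀ : a ↦ (φ ⊗ 1) (f (x₀ ⊗ a))` of the previous lemma is `R`-LINEAR as soon as `f`
also commutes with the `(φ.smulRight z) ⊗ 1` (which it does by hypothesis): `φ₀ (r • a) = r • φ₀ a`.
[cite: Jacobson, Ch. III §18 Theorem 20' (p0130)] -/
theorem lid_rTensor_map_tmul_smul (f : M ⊗[R] A →+ M ⊗[R] B) {x₀ : M} {φ : M →ₗ[R] R}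
    (hφ : φ x₀ = 1)
    (hf : ∀ (z : M) (t : M ⊗[R] A), f ((φ.smulRight z).rTensor A t) = (φ.smulRight z).rTensor B (f t))
    (r : R) (a : A) :
    TensorProduct.lid R B (φ.rTensor B (f (x₀ ⊗ₜ[R] (r • a)))) =
      r • TensorProduct.lid R B (φ.rTensor B (f (x₀ ⊗ₜ[R] a))) := by
  have h2 : f (x₀ ⊗ₜ[R] (r • a)) =
      (r • x₀) ⊗ₜ[R] TensorProduct.lid R B (φ.rTensor B (f (x₀ ⊗ₜ[R] a))) := by
    rw [← TensorProduct.smul_tmul]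
    exact map_tmul_eq_tmul_of_forall_rTensor_smulRight f hφ hf (r • x₀) a
  rw [h2, LinearMap.rTensor_tmul, TensorProduct.lid_tmul, map_smul, hφ, smul_eq_mul, mul_one]

/-- **Bijectivity descends to `φ₀`** (injectivity half): under the same hypotheses, if `f` is
injective then so is `φ₀` (`x₀ ⊗ φ₀ a = f (x₀ ⊗ a)` and `a ↦ x₀ ⊗ a` is injective, split by
`φ ⊗ 1`). [cite: Jacobson, Ch. III §18 Theorem 20' (p0130)] -/
theorem injective_lid_rTensor_map_tmul (f : M ⊗[R] A →+ M ⊗[R] B) {x₀ : M} {φ : M →ₗ[R] R}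
    (hφ : φ x₀ = 1)
    (hf : ∀ (z : M) (t : M ⊗[R] A), f ((φ.smulRight z).rTensor A t) = (φ.smulRight z).rTensor B (f t))
    (hinj : Function.Injective f) :
    Function.Injective fun a : A => TensorProduct.lid R B (φ.rTensor B (f (x₀ ⊗ₜ[R] a))) := by
  intro a a' h
  have ha := map_tmul_eq_tmul_of_forall_rTensor_smulRight f hφ hf x₀ a
  have ha' := map_tmul_eq_tmul_of_forall_rTensor_smulRight f hφ hf x₀ a'
  have hx : f (x₀ ⊗ₜ[R] a) = f (x₀ ⊗ₜ[R] a') := by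
    rw [ha, ha']; exact congrArg _ h
  have := hinj hx
  -- split `a ↦ x₀ ⊗ a` by `(φ ⊗ 1)` and `R ⊗ A = A`
  have h5 := congrArg (fun t => TensorProduct.lid R A (φ.rTensor A t)) this
  simpa [hφ] using h5

/-- **Bijectivity descends to `φ₀`** (surjectivity half): if `f` is surjective then so is `φ₀`
(read `f t = x₀ ⊗ b` through `φ ⊗ 1`). [cite: Jacobson, Ch. III §18 Theorem 20' (p0130)] -/
theorem surjective_lid_rTensor_map_tmul (f : M ⊗[R] A →+ M ⊗[R] B) {x₀ : M} {φ : M →ₗ[R] R}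
    (hφ : φ x₀ = 1)
    (hf : ∀ (z : M) (t : M ⊗[R] A), f ((φ.smulRight z).rTensor A t) = (φ.smulRight z).rTensor B (f t))
    (hsurj : Function.Surjective f) :
    Function.Surjective fun a : A => TensorProduct.lid R B (φ.rTensor B (f (x₀ ⊗ₜ[R] a))) := by
  intro b
  obtain ⟨t, ht⟩ := hsurj (x₀ ⊗ₜ[R] b)
  refine ⟨TensorProduct.lid R A (φ.rTensor A t), ?_⟩
  -- `f` commutes with `(φ.smulRight x₀) ⊗ 1 = (t ↦ x₀ ⊗ (φ ⊗ 1) t)`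
  have h6 := hf x₀ t
  rw [rTensor_smulRight_apply, rTensor_smulRight_apply, ht] at h6
  have h7 := map_tmul_eq_tmul_of_forall_rTensor_smulRight f hφ hf x₀
    (TensorProduct.lid R A (φ.rTensor A t))
  rw [h7] at h6
  have h8 := congrArg (fun s => TensorProduct.lid R B (φ.rTensor B s)) h6
  simpa [hφ] using h8

end Tensor

section Free

variable {R : Type*} [CommSemiring R] {M : Type*} [AddCommMonoid M] [Module R M] {ι : Type*}

/-- A basis vector and its coordinate form are a unimodular pair: `b.coord i (b i) = 1`. [cite: Jacobson, Ch. III §18 Theorem 20' (p0130)] -/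
theorem Basis.coord_apply_self_eq_one (b : Module.Basis ι R M) (i : ι) : b.coord i (b i) = 1 := by
  simp [Module.Basis.coord_apply, Module.Basis.repr_self]

/-- **Free-module form** (Jacobson III §18 Thm 20′-type, for a free module with a named basis
vector over a commutative ring, additive maps): an additive `f : M → M` commuting with EVERY
`R`-linear endomorphism of `M` is `z ↦ u • z` with `u = b.coord i (f (b i))`; if `f` is onto, `u`
is a unit. [cite: Jacobson, Ch. III §18 Theorem 20' (p0130)] -/
theorem exists_units_smul_eq_of_forall_comp_eq_comp (b : Module.Basis ι R M) (i : ι) (f : M →+ M)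
    (hf : ∀ g : M →ₗ[R] M, f.comp g.toAddMonoidHom = g.toAddMonoidHom.comp f)
    (hsurj : Function.Surjective f) : ∃ u : Rˣ, ∀ z : M, f z = (u : R) • z :=
  exists_units_smul_eq_of_forall_apply_smulRight f (Basis.coord_apply_self_eq_one b i)
    (fun x y => by simpa using DFunLike.congr_fun (hf ((b.coord i).smulRight x)) y) hsurj

/-- The scalar itself, without surjectivity: `f z = b.coord i (f (b i)) • z`. [cite: Jacobson, Ch. III §18 Theorem 20' (p0130)] -/
theorem apply_eq_coord_smul_of_forall_comp_eq_comp (b : Module.Basis ι R M) (i : ι) (f : M →+ M)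
    (hf : ∀ g : M →ₗ[R] M, f.comp g.toAddMonoidHom = g.toAddMonoidHom.comp f) (z : M) :
    f z = b.coord i (f (b i)) • z :=
  apply_eq_smul_of_forall_apply_smulRight f (Basis.coord_apply_self_eq_one b i)
    (fun x y => by simpa using DFunLike.congr_fun (hf ((b.coord i).smulRight x)) y) z

end Free

end Literature.LinearAlgebra
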